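import Literature.Analysis.FluidPDE.HyperbolicDSSOrbit
import Mathlib.Analysis.SpecialFunctions.Log.Deriv
import Mathlib.MeasureTheory.Integral.IntervalIntegral.FundThmCalculus
import HarnessLib

/-!
# The «log-correction» readout on an exact (rotated) DSS orbit: sup-norm period, chain rule, period mean `½`

Summits/NavierStokesRegularity support file for item stmt-NavierStokesRegularity-0155 (`DssFarFieldSlaving.BlowupTypeIDssProfile`, the
certificate endpoint of the profile-search zones Z2/Z7 of cell ns-blowup); everything proved; no definitions, no named facts.

Zone Z7 of the D-0081 profile search («generalised self-similar with logarithmic correction (DSS / log-periodic ansatz) as a fixed point of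
the renormalised map `P_λ`») reads every trajectory through the Z1 modulation gauge: with `M(s) := sup_y ‖U(y, s)‖` the sup-norm of the
backward similarity (Leray) orbit `U = lerayOrbit u` (`U(y, s) = √(−t) u(x, t)`, `y = x/√(−t)`, `s = −log(−t)`, blow-up at the space–time
origin), the instantaneous length scale is `λ(t)² := (−t)/M(s)²` and the «N-a readout» is `a(t) := −½ d(λ²)/dt` (so that an exactly
self-similar orbit, `M` constant, reads `a · M² ≡ ½`; a Type-II «log-corrected» object reads `a(t) M(s)² → 0`).  This file makes the three
facts behind the zone's census row Z7-R2 («a fixed point of `P_λ` has period-mean readout exactly `½`; `a → 0` is a DRIFTING object, never a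
fixed point» — KILLSHEET-B-Z58 §4.1/§4.3, ENGINE-Z7B §1.3, CENSUS-HOOKS H2) kernel statements:

* `norm_lerayOrbit_add_period` / `range_norm_lerayOrbit_add_period` / `iSup_norm_lerayOrbit_add_period` /
  `periodic_iSup_norm_lerayOrbit` — on a rotated `c`-DSS field (`IsRotatedDSS c R u`, `1 < c` or just `0 < c`) the slice sup-norm
  `s ↦ ⨆ y, ‖U(y, s)‖` is periodic with period `L = 2 log c` (the rotation `R` is an isometry, so the twisted periodicity
  `U(·, s + L) = R⁻¹ U(R ·, s)` of `IsRotatedDSS.lerayOrbit_add_period` is invisible to the sup-norm);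
* `hasDerivAt_lengthScaleSq` — the CHAIN RULE behind the readout: for any `C¹` positive `M` and `t < 0`, with `s = −log(−t)`,
  `d/dt [(−t)/M(−log(−t))²] = −2 (½ + M′(s)/M(s)) / M(s)²`, i.e. `a(t) · M(s)² = ½ + (log M)′(s)` EXACTLY
  (`readout_mul_sq_eq_half_add_logDeriv`);
* `periodMean_supNorm_readout_eq_half` / `not_isRotatedDSS_of_periodMean_ne_half` (appended) — the two facts combined in ORBIT language: on a
  rotated `c`-DSS field with positive `C¹` slice sup-norm, the windowed mean of the readout over any window of length `2 log c` is exactly `½`;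
  a non-`½` windowed mean refutes `IsRotatedDSS c R u` (drift diagnostic);
* `intervalIntegral_half_add_logDeriv_eq` / `periodMean_readout_eq_half` — for any `C¹` positive `M` with `M(s₀ + L) = M(s₀)`,
  `∫_{s₀}^{s₀+L} (½ + M′/M) ds = L/2`: the period mean of `a · M²` over one period of an `L`-periodic sup-norm is exactly `½`
  (`∫ (log M)′ = [log M] = 0`), whatever the profile.  Consequence used by the zone word: «consistent with `a(τ) → 0`» is EMPTY on
  fixed points of `P_λ`; a non-`½` period mean is a drift print on a non-converged trajectory, not a property of an object.

Honest framing: elementary real analysis (isometry invariance of a norm, one chain rule, one fundamental theorem of calculus); the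
sup-norm lemmas are stated for the accepted `Literature.Analysis.FluidPDE.lerayOrbit` / `IsRotatedDSS`; nothing here asserts that a DSS
profile exists or does not exist, and nothing is a statement about Navier–Stokes dynamics (no equation is used).
WHAT THIS IS NOT: not NS — bookkeeping identities for a numerical readout; `violates:` none (no object).
-/

set_option linter.dupNamespace false

namespace Summit.NavierStokesRegularity.NavierStokesRegularity.Theorems.ModulationReadout

open Literature.Analysis.FluidPDE Real MeasureTheory Set

section SupNormPeriod

variable {E : Type*} [NormedAddCommGroup E] [InnerProductSpace ℝ E]

/-- **Pointwise form of the sup-norm periodicity.** On a rotated `c`-DSS field, `‖U(y, s + 2 log c)‖ = ‖U(R y, s)‖`: the twisted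
periodicity `U(·, s + 2 log c) = R⁻¹ U(R ·, s)` (`IsRotatedDSS.lerayOrbit_add_period`) seen through the norm, the isometry `R⁻¹`
dropping out. [folklore] -/
theorem norm_lerayOrbit_add_period {c : ℝ} {R : E ≃ₗᵢ[ℝ] E} {u : ℝ → E → E} (h : IsRotatedDSS c R u)
    (hc : 0 < c) (s : ℝ) (y : E) :
    ‖lerayOrbit u (s + 2 * Real.log c) y‖ = ‖lerayOrbit u s (R y)‖ := by
  rw [h.lerayOrbit_add_period hc s y, LinearIsometryEquiv.norm_map]

/-- **The set of slice norms is periodic**: `{‖U(y, s + 2 log c)‖ : y} = {‖U(y, s)‖ : y}` (the rotation `R` is a bijection of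
`E`). [folklore] -/
theorem range_norm_lerayOrbit_add_period {c : ℝ} {R : E ≃ₗᵢ[ℝ] E} {u : ℝ → E → E} (h : IsRotatedDSS c R u)
    (hc : 0 < c) (s : ℝ) :
    Set.range (fun y => ‖lerayOrbit u (s + 2 * Real.log c) y‖) = Set.range (fun y => ‖lerayOrbit u s y‖) := by
  ext r
  constructor
  · rintro ⟨y, rfl⟩
    exact ⟨R y, (norm_lerayOrbit_add_period h hc s y).symm⟩
  · rintro ⟨y, rfl⟩
    refine ⟨R.symm y, ?_⟩
    show ‖lerayOrbit u (s + 2 * Real.log c) (R.symm y)‖ = ‖lerayOrbit u s y‖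
    rw [norm_lerayOrbit_add_period h hc s (R.symm y), LinearIsometryEquiv.apply_symm_apply]

/-- **The slice sup-norm `M(s) := ⨆_y ‖U(y, s)‖` is `2 log c`-periodic** on a rotated `c`-DSS field (ENGINE-Z7B §1.3 / KILLSHEET-B-Z58
§4.3: «`M` is `L`-periodic on a twisted-periodic orbit because `R_θ` preserves the norm»).  No boundedness is needed: the equality is an
equality of suprema of EQUAL sets (for an unbounded slice both sides are the junk value `sSup` assigns). [folklore] -/
theorem iSup_norm_lerayOrbit_add_period {c : ℝ} {R : E ≃ₗᵢ[ℝ] E} {u : ℝ → E → E} (h : IsRotatedDSS c R u)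
    (hc : 0 < c) (s : ℝ) :
    (⨆ y, ‖lerayOrbit u (s + 2 * Real.log c) y‖) = ⨆ y, ‖lerayOrbit u s y‖ := by
  rw [iSup, iSup, range_norm_lerayOrbit_add_period h hc s]

/-- **Periodicity packaged**: `Function.Periodic (s ↦ ⨆_y ‖U(y, s)‖) (2 log c)`. [folklore] -/
theorem periodic_iSup_norm_lerayOrbit {c : ℝ} {R : E ≃ₗᵢ[ℝ] E} {u : ℝ → E → E} (h : IsRotatedDSS c R u)
    (hc : 0 < c) :
    Function.Periodic (fun s => ⨆ y, ‖lerayOrbit u s y‖) (2 * Real.log c) :=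
  fun s => iSup_norm_lerayOrbit_add_period h hc s

/-- **Type-I bound on the slice sup-norm**: under `HasTypeIDecay C₀ u` every slice norm is `≤ C₀`, so `M(s) ≤ C₀` for all `s`
(the set of slice norms is bounded above by `C₀`; with `HasTypeIDecay.norm_lerayOrbit_le`, `‖U(y, s)‖ ≤ C₀/(‖y‖ + 1) ≤ C₀`).
In the Z7 census this is the statement «the readout's `M(s)` of an exact Type-I(C₀) DSS orbit lives in `[0, C₀]`». [folklore] -/
theorem iSup_norm_lerayOrbit_le {C₀ : ℝ} {u : ℝ → E → E} (h : HasTypeIDecay C₀ u) (hC : 0 ≤ C₀) (s : ℝ) :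
    (⨆ y, ‖lerayOrbit u s y‖) ≤ C₀ := by
  have hb : ∀ y, ‖lerayOrbit u s y‖ ≤ C₀ := fun y => by
    refine (h.norm_lerayOrbit_le s y).trans ?_
    rw [div_le_iff₀ (by positivity)]
    nlinarith [norm_nonneg y]
  rcases isEmpty_or_nonempty E with hE | hE
  · simp only [Real.iSup_of_isEmpty]; exact hC
  · exact ciSup_le hb

end SupNormPeriod

section Readout

/-- **Chain rule behind the N-a readout.** For a positive `C¹`-at-the-point function `M` and `t < 0`, put `s := −log(−t)` and
`λ(t)² := (−t)/M(−log(−t))²`.  Then `d(λ²)/dt = −2 (½ + M′(s)/M(s))/M(s)²` — equivalently `a · M² = ½ + (log M)′` for the readout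
`a := −½ d(λ²)/dt` (ENGINE-Z7B §1.3; KILLSHEET-B-Z58 §4.3 «RE-DERIVED»).  Ingredients: `d/dt(−t) = −1`, `ds/dt = 1/(−t)`,
`d/ds M⁻² = −2 M′/M³`. [folklore] -/
theorem hasDerivAt_lengthScaleSq {M : ℝ → ℝ} {M' t : ℝ} (ht : t < 0)
    (hM : HasDerivAt M M' (-Real.log (-t))) (hpos : 0 < M (-Real.log (-t))) :
    HasDerivAt (fun τ : ℝ => (-τ) / M (-Real.log (-τ)) ^ 2)
      (-2 * ((1 / 2 + M' / M (-Real.log (-t))) / M (-Real.log (-t)) ^ 2)) t := by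
  have hnt : 0 < -t := by linarith
  have hnt' : (-t) ≠ 0 := hnt.ne'
  -- `τ ↦ −τ` and `s(τ) = −log(−τ)` (derivative `1/(−t)` at `t`)
  have hneg : HasDerivAt (fun τ : ℝ => -τ) (-1) t := hasDerivAt_neg' t
  have hlog : HasDerivAt (fun τ : ℝ => Real.log (-τ)) ((-t)⁻¹ * (-1)) t :=
    (Real.hasDerivAt_log hnt').comp t hneg
  have hs : HasDerivAt (fun τ : ℝ => -Real.log (-τ)) (-((-t)⁻¹ * (-1))) t := hlog.neg
  -- `M ∘ s` and its square
  have hMs : HasDerivAt (fun τ : ℝ => M (-Real.log (-τ))) (M' * (-((-t)⁻¹ * (-1)))) t := hM.comp t hs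
  have hM2 : HasDerivAt (fun τ : ℝ => M (-Real.log (-τ)) * M (-Real.log (-τ)))
      (M' * (-((-t)⁻¹ * (-1))) * M (-Real.log (-t)) + M (-Real.log (-t)) * (M' * (-((-t)⁻¹ * (-1))))) t :=
    hMs.mul hMs
  have hne : M (-Real.log (-t)) * M (-Real.log (-t)) ≠ 0 := mul_ne_zero hpos.ne' hpos.ne'
  have hq := hneg.div hM2 hne
  have hfun : (fun τ : ℝ => (-τ) / M (-Real.log (-τ)) ^ 2) = fun τ : ℝ => (-τ) / (M (-Real.log (-τ)) * M (-Real.log (-τ))) := by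
    funext τ; rw [sq]
  rw [hfun]
  refine hq.congr_deriv ?_
  have hM0 : M (-Real.log (-t)) ≠ 0 := hpos.ne'
  have ht0 : t ≠ 0 := ht.ne
  generalize M (-Real.log (-t)) = m at hM0 ⊢
  have h1 : (-t)⁻¹ * (-1 : ℝ) = t⁻¹ := by rw [inv_neg]; ring
  rw [h1]
  field_simp
  ring

/-- **The readout identity `a · M² = ½ + (log M)′`** in its cleanest form: with the hypotheses of `hasDerivAt_lengthScaleSq`,
`(−½ · d(λ²)/dt) · M(s)² = ½ + M′(s)/M(s)`, and `M′/M` is the derivative of `log ∘ M` at `s`. [folklore] -/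
theorem readout_mul_sq_eq_half_add_logDeriv {M : ℝ → ℝ} {M' t : ℝ} (ht : t < 0)
    (hM : HasDerivAt M M' (-Real.log (-t))) (hpos : 0 < M (-Real.log (-t))) :
    (-(1 / 2 : ℝ) * deriv (fun τ : ℝ => (-τ) / M (-Real.log (-τ)) ^ 2) t) * M (-Real.log (-t)) ^ 2
        = 1 / 2 + M' / M (-Real.log (-t))
      ∧ HasDerivAt (fun σ => Real.log (M σ)) (M' / M (-Real.log (-t))) (-Real.log (-t)) := by
  refine ⟨?_, hM.log hpos.ne'⟩
  rw [(hasDerivAt_lengthScaleSq ht hM hpos).deriv]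
  have hne : M (-Real.log (-t)) ≠ 0 := hpos.ne'
  have hne2 : M (-Real.log (-t)) ^ 2 ≠ 0 := pow_ne_zero 2 hne
  calc -(1 / 2 : ℝ) * (-2 * ((1 / 2 + M' / M (-Real.log (-t))) / M (-Real.log (-t)) ^ 2)) * M (-Real.log (-t)) ^ 2
      = (1 / 2 + M' / M (-Real.log (-t))) * (M (-Real.log (-t)) ^ 2 / M (-Real.log (-t)) ^ 2) := by ring
    _ = 1 / 2 + M' / M (-Real.log (-t)) := by rw [div_self hne2, mul_one]

/-- **Period mean of the readout is exactly `½`.** For a positive function `M` with a continuous derivative `M′` and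
`M(s₀ + L) = M(s₀)` (one period of an `L`-periodic sup-norm), `∫_{s₀}^{s₀+L} (½ + M′(s)/M(s)) ds = L/2`
(`∫ (log M)′ = log M(s₀ + L) − log M(s₀) = 0`).  KILLSHEET-B-Z58 §4.3: «`(1/L)∮ a·M² ds = ½` EXACTLY for any `L`-periodic `M`» —
hence «consistent with `a(τ) → 0`» is empty on a fixed point of `P_λ`. [folklore] -/
theorem intervalIntegral_half_add_logDeriv_eq {M M' : ℝ → ℝ} {s₀ L : ℝ} (hM : ∀ s, HasDerivAt M (M' s) s)
    (hM' : Continuous M') (hpos : ∀ s, 0 < M s) (hper : M (s₀ + L) = M s₀) :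
    ∫ s in s₀..(s₀ + L), (1 / 2 + M' s / M s) = L / 2 := by
  have hMc : Continuous M := continuous_iff_continuousAt.2 fun s => (hM s).continuousAt
  have hq : Continuous fun s => M' s / M s := hM'.div hMc fun s => (hpos s).ne'
  have hlog : ∀ s, HasDerivAt (fun σ => Real.log (M σ)) (M' s / M s) s := fun s => (hM s).log (hpos s).ne'
  rw [intervalIntegral.integral_add intervalIntegrable_const (hq.intervalIntegrable _ _),
    intervalIntegral.integral_const,
    intervalIntegral.integral_eq_sub_of_hasDerivAt (fun s _ => hlog s) (hq.intervalIntegrable _ _), hper]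
  simp only [smul_eq_mul, sub_self, add_zero]
  ring

/-- **Period mean, normalised**: under the same hypotheses and `L ≠ 0`, `(1/L) ∫_{s₀}^{s₀+L} (½ + M′/M) = ½`. [folklore] -/
theorem periodMean_readout_eq_half {M M' : ℝ → ℝ} {s₀ L : ℝ} (hL : L ≠ 0) (hM : ∀ s, HasDerivAt M (M' s) s)
    (hM' : Continuous M') (hpos : ∀ s, 0 < M s) (hper : M (s₀ + L) = M s₀) :
    (1 / L) * ∫ s in s₀..(s₀ + L), (1 / 2 + M' s / M s) = 1 / 2 := by
  rw [intervalIntegral_half_add_logDeriv_eq hM hM' hpos hper]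
  field_simp

/-- **Drift form** (the contrapositive the zone word uses): if over some window `[s₀, s₀ + L]`, `L ≠ 0`, the normalised mean of the
readout `½ + M′/M` differs from `½`, then `M(s₀ + L) ≠ M(s₀)` — the trajectory is NOT `L`-periodic in sup-norm there (a drift print,
not a fixed point of `P_λ` with that period). [folklore] -/
theorem sup_norm_not_periodic_of_periodMean_ne_half {M M' : ℝ → ℝ} {s₀ L : ℝ} (hL : L ≠ 0)
    (hM : ∀ s, HasDerivAt M (M' s) s) (hM' : Continuous M') (hpos : ∀ s, 0 < M s)
    (hmean : (1 / L) * ∫ s in s₀..(s₀ + L), (1 / 2 + M' s / M s) ≠ 1 / 2) :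
    M (s₀ + L) ≠ M s₀ :=
  fun hper => hmean (periodMean_readout_eq_half hL hM hM' hpos hper)

end Readout

section OrbitReadout

variable {E : Type*} [NormedAddCommGroup E] [InnerProductSpace ℝ E]

/-- **Z7-R2 in orbit language (one citable statement).** On a rotated `c`-DSS field (`0 < c`, `c ≠ 1`) whose Leray-orbit slice
sup-norm `M(s) := ⨆_y ‖U(y, s)‖` is positive and differentiable with a continuous derivative `M′`, the readout `½ + M′/M` has mean EXACTLY `½`
over every window of one period `2 log c`: `(1/(2 log c)) ∫_{s₀}^{s₀ + 2 log c} (½ + M′(s)/M(s)) ds = ½` — `periodMean_readout_eq_half` fed with the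
periodicity `periodic_iSup_norm_lerayOrbit`.  (Differentiability of the sup-norm is a HYPOTHESIS here — the engines' `M` is a grid maximum read as a
smooth function of `s`; the lemma is the bookkeeping identity behind KILLSHEET-B-Z58 §4.3's «`(1/L)∮ a·M² ds = ½` EXACTLY», not a regularity claim.) [folklore] -/
theorem periodMean_supNorm_readout_eq_half {c : ℝ} {R : E ≃ₗᵢ[ℝ] E} {u : ℝ → E → E} (h : IsRotatedDSS c R u)
    (hc : 0 < c) (hc1 : c ≠ 1) {M' : ℝ → ℝ}
    (hM : ∀ s, HasDerivAt (fun σ => ⨆ y, ‖lerayOrbit u σ y‖) (M' s) s) (hM' : Continuous M')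
    (hpos : ∀ s, 0 < ⨆ y, ‖lerayOrbit u s y‖) (s₀ : ℝ) :
    (1 / (2 * Real.log c)) * ∫ s in s₀..(s₀ + 2 * Real.log c), (1 / 2 + M' s / ⨆ y, ‖lerayOrbit u s y‖) = 1 / 2 := by
  have hL : 2 * Real.log c ≠ 0 := mul_ne_zero two_ne_zero (Real.log_ne_zero_of_pos_of_ne_one hc hc1)
  exact periodMean_readout_eq_half (M := fun σ => ⨆ y, ‖lerayOrbit u σ y‖) hL hM hM' hpos
    (periodic_iSup_norm_lerayOrbit h hc s₀)

/-- **Contrapositive in orbit language**: a window `[s₀, s₀ + L]`, `L ≠ 0`, over which the normalised mean of the sup-norm readout is NOT `½` is not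
a sup-norm period — in particular (with `L = 2 log c`) the field is not a rotated `c`-DSS field with a positive `C¹` sup-norm. The zone word's use:
a non-`½` windowed mean printed on a trajectory is a DRIFT diagnostic (TEMPLATE N3), never a property of a fixed point of `P_λ`. [folklore] -/
theorem not_isRotatedDSS_of_periodMean_ne_half {c : ℝ} {R : E ≃ₗᵢ[ℝ] E} {u : ℝ → E → E} (hc : 0 < c) (hc1 : c ≠ 1)
    {M' : ℝ → ℝ} (hM : ∀ s, HasDerivAt (fun σ => ⨆ y, ‖lerayOrbit u σ y‖) (M' s) s) (hM' : Continuous M')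
    (hpos : ∀ s, 0 < ⨆ y, ‖lerayOrbit u s y‖) {s₀ : ℝ}
    (hmean : (1 / (2 * Real.log c)) * ∫ s in s₀..(s₀ + 2 * Real.log c), (1 / 2 + M' s / ⨆ y, ‖lerayOrbit u s y‖) ≠ 1 / 2) :
    ¬ IsRotatedDSS c R u :=
  fun h => hmean (periodMean_supNorm_readout_eq_half h hc hc1 hM hM' hpos s₀)

end OrbitReadout

section LevelDictionary

/-! ### The level dictionary `M(s) = e^{−s/2} · sup_x ‖u(−e^{−s}, x)‖` and its two readings (ENGINE-Z7B §1.3 (ii), rider R2)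

ENGINE B of zone Z7 (the time-stepper twin, HOME/profile/z7twin/ENGINE-Z7B.md) prints along every forward evolution of a seed in Leray
variables the slice sup-norm `M(s) = ⨆_y ‖U(y, s)‖` («does the level run away», TEMPLATE N3; census rider R2: 53/53 IVP legs DECAY,
fitted rates `0.644–1.207` per unit `s`).  The dictionary below turns the three readings of that print into kernel statements about the
PHYSICAL field `u`: `M(s)` is `e^{−s/2}` times the physical sup-norm at time `t = −e^{−s}` (`iSup_norm_lerayOrbit_eq`); hence
(a) if `u` stays bounded by `B` on the time window `[−1, 0)` («regular through the rescaling time») then `M(s) ≤ e^{−s/2} B` for every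
`s ≥ 0` — decay at rate AT LEAST `½` is the signature of the regular basin, whatever the seed (`iSup_norm_lerayOrbit_le_exp_mul_of_bounded`);
(b) a level FLOOR `m ≤ ‖U(y_s, s)‖` along `s → ∞` forces `‖u(t, x_t)‖ ≥ m/√(−t)`, i.e. Type-I-rate growth and `u` unbounded on every
backward neighbourhood of the origin (`div_sqrt_le_norm_of_le_norm_lerayOrbit`, `exists_norm_gt_of_lerayOrbit_floor`);
(c) for an EXACT rotated-DSS orbit the tree already holds the sharper form `IsRotatedDSS.eq_zero_of_norm_le_parabolicCylinder`
(bounded near the origin ⇒ trivial), which is why a fixed point of `P_λ` can only sit in reading (b).  Elementary (one `norm_smul`, one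
reindexing of a supremum along the onto homothety `y ↦ e^{−s/2} y`, one choice of a large `s`); no equation is used; nothing here says
which reading a Navier–Stokes evolution takes.  WHAT THIS IS NOT: not NS — bookkeeping for a numerical print; `violates:` none (no object).
-/

variable {E : Type*} [NormedAddCommGroup E] [NormedSpace ℝ E]
variable {F : Type*} [NormedAddCommGroup F] [NormedSpace ℝ F]

/-- **Pointwise dictionary**: `‖U(y, s)‖ = e^{−s/2} ‖u(−e^{−s}, e^{−s/2} y)‖`. [folklore] -/
theorem norm_lerayOrbit_eq (u : ℝ → E → F) (s : ℝ) (y : E) :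
    ‖lerayOrbit u s y‖ = Real.exp (-s / 2) * ‖u (-Real.exp (-s)) (Real.exp (-s / 2) • y)‖ := by
  rw [lerayOrbit_apply, norm_smul, Real.norm_of_nonneg (Real.exp_pos _).le]

/-- **Level dictionary for the slice sup-norm**: `⨆_y ‖U(y, s)‖ = e^{−s/2} · ⨆_x ‖u(−e^{−s}, x)‖`.  The homothety `y ↦ e^{−s/2} y`
is onto, so both suprema run over the same set of values; no boundedness hypothesis is needed (for an unbounded slice both sides carry
the same junk value). [folklore] -/
theorem iSup_norm_lerayOrbit_eq (u : ℝ → E → F) (s : ℝ) :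
    (⨆ y, ‖lerayOrbit u s y‖) = Real.exp (-s / 2) * ⨆ x, ‖u (-Real.exp (-s)) x‖ := by
  have hsurj : Function.Surjective fun y : E => Real.exp (-s / 2) • y := fun x =>
    ⟨(Real.exp (-s / 2))⁻¹ • x, by simp only [smul_smul, mul_inv_cancel₀ (Real.exp_pos _).ne', one_smul]⟩
  simp only [norm_lerayOrbit_eq]
  rw [Real.mul_iSup_of_nonneg (Real.exp_pos _).le]
  exact hsurj.iSup_comp fun x => Real.exp (-s / 2) * ‖u (-Real.exp (-s)) x‖

/-- **(a) Regular-basin reading, one slice**: if the physical slice at `t = −e^{−s}` is bounded, `‖u(−e^{−s}, x)‖ ≤ B` for all `x`,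
then `M(s) ≤ e^{−s/2} B`. [folklore] -/
theorem iSup_norm_lerayOrbit_le_exp_mul (u : ℝ → E → F) {s B : ℝ} (hB : ∀ x, ‖u (-Real.exp (-s)) x‖ ≤ B) :
    (⨆ y, ‖lerayOrbit u s y‖) ≤ Real.exp (-s / 2) * B := by
  haveI : Nonempty E := ⟨0⟩
  refine ciSup_le fun y => ?_
  rw [norm_lerayOrbit_eq]
  exact mul_le_mul_of_nonneg_left (hB _) (Real.exp_pos _).le

/-- **(a) Regular-basin reading, window form**: if `‖u(t, x)‖ ≤ B` for all `t ∈ [−1, 0)` and all `x` (the seed's evolution stays bounded up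
to the rescaling time), then `M(s) ≤ e^{−s/2} B` for every `s ≥ 0`: along a BOUNDED evolution the Leray level decays at rate at least `½` —
the kernel content of rider R2's «every forward evolution decays» (ENGINE B fitted `0.644–1.207 ≥ ½` on 53/53 legs: the excess over `½` is
the physical slice norm itself decreasing). [folklore] -/
theorem iSup_norm_lerayOrbit_le_exp_mul_of_bounded (u : ℝ → E → F) {B : ℝ}
    (hB : ∀ t ∈ Set.Ico (-1 : ℝ) 0, ∀ x, ‖u t x‖ ≤ B) {s : ℝ} (hs : 0 ≤ s) :
    (⨆ y, ‖lerayOrbit u s y‖) ≤ Real.exp (-s / 2) * B := by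
  refine iSup_norm_lerayOrbit_le_exp_mul u fun x => hB _ ⟨?_, neg_lt_zero.mpr (Real.exp_pos _)⟩ x
  have : Real.exp (-s) ≤ 1 := Real.exp_le_one_iff.mpr (by linarith)
  linarith

/-- **Inverse pointwise dictionary**: for `t < 0`, `‖u(t, √(−t) y)‖ = ‖U(y, −log(−t))‖ / √(−t)` (`eq_lerayOrbit_of_neg` seen through
the norm). [folklore] -/
theorem norm_apply_sqrt_smul_eq (u : ℝ → E → F) {t : ℝ} (ht : t < 0) (y : E) :
    ‖u t (Real.sqrt (-t) • y)‖ = (Real.sqrt (-t))⁻¹ * ‖lerayOrbit u (-Real.log (-t)) y‖ := by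
  have hs : 0 < Real.sqrt (-t) := Real.sqrt_pos.mpr (neg_pos.mpr ht)
  rw [eq_lerayOrbit_of_neg u ht, smul_smul, inv_mul_cancel₀ hs.ne', one_smul, norm_smul,
    Real.norm_of_nonneg (inv_nonneg.mpr hs.le)]

/-- **(b) A level floor is a Type-I-rate lower bound, one slice**: `m ≤ ‖U(y, −log(−t))‖` at some `y` (with `t < 0`) gives the physical
point `x = √(−t) y` with `m/√(−t) ≤ ‖u(t, x)‖`. [folklore] -/
theorem div_sqrt_le_norm_of_le_norm_lerayOrbit (u : ℝ → E → F) {t m : ℝ} (ht : t < 0) {y : E}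
    (hy : m ≤ ‖lerayOrbit u (-Real.log (-t)) y‖) : m / Real.sqrt (-t) ≤ ‖u t (Real.sqrt (-t) • y)‖ := by
  rw [norm_apply_sqrt_smul_eq u ht, div_eq_inv_mul]
  exact mul_le_mul_of_nonneg_left hy (inv_nonneg.mpr (Real.sqrt_nonneg _))

/-- **(b) A level floor makes `u` unbounded near the origin**: if for every `s ≥ s₀` some slice point has `m ≤ ‖U(y, s)‖` with `m > 0`
(«the level does not decay»), then for every `B` and every `δ > 0` there are `t ∈ (−δ, 0)` and `x` with `B < ‖u(t, x)‖` — the print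
read as a statement about `u` (choose `s ≥ s₀` with `e^{−s} < δ` and `B/m < e^{s/2}`, `t = −e^{−s}`, `x = √(−t) y_s`).  For an exact
rotated-DSS orbit the tree's `IsRotatedDSS.eq_zero_of_norm_le_parabolicCylinder` is the sharper statement. [folklore] -/
theorem exists_norm_gt_of_lerayOrbit_floor (u : ℝ → E → F) {s₀ m : ℝ} (hm : 0 < m)
    (h : ∀ s, s₀ ≤ s → ∃ y, m ≤ ‖lerayOrbit u s y‖) (B : ℝ) {δ : ℝ} (hδ : 0 < δ) :
    ∃ t ∈ Set.Ioo (-δ) 0, ∃ x, B < ‖u t x‖ := by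
  have h1 : ∀ᶠ s in Filter.atTop, s₀ ≤ s := Filter.eventually_ge_atTop s₀
  have h2 : ∀ᶠ s in Filter.atTop, Real.exp (-s) < δ :=
    Real.tendsto_exp_neg_atTop_nhds_zero.eventually (gt_mem_nhds hδ)
  have h3 : ∀ᶠ s in Filter.atTop, B / m < Real.exp (s / 2) := by
    have : Filter.Tendsto (fun s : ℝ => Real.exp (s / 2)) Filter.atTop Filter.atTop :=
      Real.tendsto_exp_atTop.comp (Filter.tendsto_id.atTop_div_const (by norm_num : (0 : ℝ) < 2))
    exact this.eventually_gt_atTop (B / m)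
  obtain ⟨s, hs₀, hsδ, hsB⟩ := (h1.and (h2.and h3)).exists
  obtain ⟨y, hy⟩ := h s hs₀
  have ht : -Real.exp (-s) < 0 := neg_lt_zero.mpr (Real.exp_pos _)
  have hlog : -Real.log (-(-Real.exp (-s))) = s := by rw [neg_neg, Real.log_exp, neg_neg]
  have hsq : Real.sqrt (-(-Real.exp (-s))) = Real.exp (-s / 2) := by rw [neg_neg, sqrt_exp_neg]
  have hy' : m ≤ ‖lerayOrbit u (-Real.log (-(-Real.exp (-s)))) y‖ := by rwa [hlog]
  have key := div_sqrt_le_norm_of_le_norm_lerayOrbit u ht hy'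
  refine ⟨-Real.exp (-s), ⟨by linarith, ht⟩, Real.sqrt (-(-Real.exp (-s))) • y, lt_of_lt_of_le ?_ key⟩
  rw [hsq, lt_div_iff₀ (Real.exp_pos _)]
  have hBm : B < m * Real.exp (s / 2) := (div_lt_iff₀' hm).mp hsB
  calc B * Real.exp (-s / 2) < m * Real.exp (s / 2) * Real.exp (-s / 2) :=
        mul_lt_mul_of_pos_right hBm (Real.exp_pos _)
    _ = m := by rw [mul_assoc, ← Real.exp_add, show s / 2 + -s / 2 = 0 by ring, Real.exp_zero, mul_one]

end LevelDictionary

end Summit.NavierStokesRegularity.NavierStokesRegularity.Theorems.ModulationReadout
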